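/-
Copyright: rh-split cell (screw, bridge) gen 19, 2026-08-28.  Splitting search over kernel-typed
RH-equivalences.  A splitting `A ∧ B ⟹ RH` is CONDITIONAL bookkeeping unless `A` and `B` are both
proved; nothing here bears on the truth of RH.
-/
import Summits.RiemannHypothesis.RiemannHypothesis.Theorems.Splittings.ScrewPrimeCellBlindnessA

/-!
# §24 «PRIME-CELL BLINDNESS» — part B of 4: §§3–6 (blindness, size, screw reading + `LatticeCeilingW`, blocks)

Carved at section boundaries from the single refereed object `ScrewPrimeCellBlindness.lean`
(rh-split cell (screw, bridge) gen 19; sha16 7ccfa4f57a1815af · 1038 l) to meet the tree line limit;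
the mathematical module docstring of record is in part A (`ScrewPrimeCellBlindnessA`).
HONEST LABEL: kernel algebra about finite prime sums; an INSTRUMENT / barrier note for the screw
column, not a splitting; RH-free; toward RH: 0.  Nothing here bears on the truth of RH.
-/

set_option linter.dupNamespace false

namespace Summit.RiemannHypothesis.RiemannHypothesis.Theorems.Splittings.ScrewPrimeCellBlindness

open Literature.NumberTheory.LFunctions
open Summit.RiemannHypothesis.RiemannHypothesis.Theorems.Splittings.ScrewLatticeContinuation
  (LatticeCeiling)

/-! ## 3. Blindness: the tent is invisible from every sample point outside its window -/

section blind

variable {a b c : ℕ} (ha : 1 ≤ a) (hab : a < b) (hbc : b < c) (w : ℕ → ℝ) (β : ℝ)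
include ha hab hbc

/-- **(K3) window blindness**: at every height `t` with `|t| ∉ (log a, log c)` the weights `w` and
`w + tent` give the same sample. -/
theorem primeSumW_add_tent_eq_of_window {t : ℝ} (ht : |t| ≤ Real.log a ∨ Real.log c ≤ |t|) :
    primeSumW (w + tent a b c β) t = primeSumW w t := by
  rw [primeSumW_add]
  rcases ht with ht | ht
  · rw [primeSumW_tent_of_le_log ha hab hbc β ht, add_zero]
  · rw [primeSumW_tent_of_log_le ha hab hbc β ht, add_zero]

/-- **Lattice blindness**: if the window sits inside one lattice cell, `k h ≤ log a` and
`log c ≤ (k+1) h` (i.e. `e^{kh} ≤ a < b < c ≤ e^{(k+1)h}`), then ALL lattice samples `φ(j h)`, `j ∈ ℕ`,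
of `w` and `w + tent` coincide. -/
theorem primeSumW_add_tent_lattice {h : ℝ} (hh : 0 ≤ h) {k : ℕ} (hka : k * h ≤ Real.log a)
    (hkc : Real.log c ≤ (k + 1) * h) (j : ℕ) :
    primeSumW (w + tent a b c β) (j * h) = primeSumW w (j * h) := by
  refine primeSumW_add_tent_eq_of_window ha hab hbc w β ?_
  rw [abs_of_nonneg (by positivity)]
  rcases Nat.lt_or_ge j (k + 1) with hj | hj
  · left
    have hj' : (j : ℝ) ≤ k := by exact_mod_cast Nat.lt_succ_iff.1 hj
    exact (mul_le_mul_of_nonneg_right hj' hh).trans hka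
  · right
    have hj' : ((k : ℝ) + 1) ≤ j := by exact_mod_cast hj
    exact hkc.trans (mul_le_mul_of_nonneg_right hj' hh)

/-- … while at the apex the samples differ by `β · B(a,b,c)`. -/
theorem primeSumW_add_tent_apex :
    primeSumW (w + tent a b c β) (Real.log b) = primeSumW w (Real.log b) + β * bumpConst a b c := by
  rw [primeSumW_add, primeSumW_tent_apex ha hab hbc]

/-- The lattice moments are blind too: outside the window both cumulative moments agree. -/
theorem moment0_add_tent_eq_of_window {t : ℝ} (ht : |t| ≤ Real.log a ∨ Real.log c ≤ |t|)
    (ht' : |t| ≠ Real.log a) :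
    moment0 (w + tent a b c β) t = moment0 w t := by
  have h1 : Real.log a < Real.log b := Real.log_lt_log (by exact_mod_cast ha) (by exact_mod_cast hab)
  have h2 : Real.log b < Real.log c :=
    Real.log_lt_log (by exact_mod_cast (show 0 < b by omega)) (by exact_mod_cast hbc)
  have hL : Real.log c - Real.log a ≠ 0 := by linarith
  have key : ∀ s : ℝ, moment0 (w + tent a b c β) s - moment0 w s =
      ∑ n ∈ Finset.Icc 1 ⌊Real.exp |s|⌋₊, tent a b c β n / Real.sqrt n := by
    intro s
    simp only [moment0, Pi.add_apply, ← Finset.sum_sub_distrib]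
    exact Finset.sum_congr rfl fun n _ ↦ by ring
  have hsq : ∀ m : ℕ, 1 ≤ m → Real.sqrt m ≠ 0 := fun m hm ↦
    (Real.sqrt_pos.2 (by exact_mod_cast hm)).ne'
  rw [← sub_eq_zero, key]
  rcases ht with ht | ht
  · -- nothing of the support is counted
    refine Finset.sum_eq_zero fun n hn ↦ ?_
    have hlt : |t| < Real.log a := lt_of_le_of_ne ht ht'
    have hna : n ≠ a := fun h' ↦ by
      have := (mem_Icc_floor_exp_iff ha t).1 (h' ▸ hn); linarith
    have hnb : n ≠ b := fun h' ↦ by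
      have := (mem_Icc_floor_exp_iff (show 1 ≤ b by omega) t).1 (h' ▸ hn); linarith
    have hnc : n ≠ c := fun h' ↦ by
      have := (mem_Icc_floor_exp_iff (show 1 ≤ c by omega) t).1 (h' ▸ hn); linarith
    rw [tent_apply_of_ne β hna hnb hnc, zero_div]
  · -- all of the support is counted: the zeroth moment of the tent vanishes
    have hma : a ∈ Finset.Icc 1 ⌊Real.exp |t|⌋₊ := (mem_Icc_floor_exp_iff ha t).2 (by linarith)
    have hmb : b ∈ Finset.Icc 1 ⌊Real.exp |t|⌋₊ :=
      (mem_Icc_floor_exp_iff (show 1 ≤ b by omega) t).2 (by linarith)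
    have hmc : c ∈ Finset.Icc 1 ⌊Real.exp |t|⌋₊ :=
      (mem_Icc_floor_exp_iff (show 1 ≤ c by omega) t).2 ht
    have hsub : ({a, b, c} : Finset ℕ) ⊆ Finset.Icc 1 ⌊Real.exp |t|⌋₊ := by
      intro n hn
      simp only [Finset.mem_insert, Finset.mem_singleton] at hn
      rcases hn with rfl | rfl | rfl <;> assumption
    rw [← Finset.sum_subset hsub (fun n _ hn ↦ by
      simp only [Finset.mem_insert, Finset.mem_singleton, not_or] at hn
      rw [tent_apply_of_ne β hn.1 hn.2.1 hn.2.2, zero_div])]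
    rw [Finset.sum_insert (by simp only [Finset.mem_insert, Finset.mem_singleton]; omega),
      Finset.sum_insert (by simp only [Finset.mem_singleton]; omega), Finset.sum_singleton,
      tent_apply_a hab hbc, tent_apply_b hab hbc, tent_apply_c hab hbc]
    have hsa := hsq a ha
    have hsb := hsq b (by omega)
    have hsc := hsq c (by omega)
    field_simp
    ring

end blind

/-! ## 4. Size and sign of the perturbed weights -/

section size

variable {a b c : ℕ} (ha : 1 ≤ a) (hab : a < b) (hbc : b < c)
include ha hab hbc

/-- The edge coefficients are at most `|β|` in absolute value. -/
theorem abs_edge_coeff_le (β : ℝ) :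
    |β * (Real.log c - Real.log b) / (Real.log c - Real.log a)| ≤ |β| ∧
      |β * (Real.log b - Real.log a) / (Real.log c - Real.log a)| ≤ |β| := by
  have h1 : Real.log a < Real.log b := Real.log_lt_log (by exact_mod_cast ha) (by exact_mod_cast hab)
  have h2 : Real.log b < Real.log c :=
    Real.log_lt_log (by exact_mod_cast (show 0 < b by omega)) (by exact_mod_cast hbc)
  have hL : 0 < Real.log c - Real.log a := by linarith
  constructor
  · rw [abs_div, abs_mul, abs_of_pos hL, abs_of_nonneg (by linarith : 0 ≤ Real.log c - Real.log b),
      div_le_iff₀ hL]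
    exact mul_le_mul_of_nonneg_left (by linarith) (abs_nonneg β)
  · rw [abs_div, abs_mul, abs_of_pos hL, abs_of_nonneg (by linarith : 0 ≤ Real.log b - Real.log a),
      div_le_iff₀ hL]
    exact mul_le_mul_of_nonneg_left (by linarith) (abs_nonneg β)

/-- **Pointwise relative smallness**: if `|β|√n ≤ η·w(n)` at the three support points, the tent changes
every weight by at most the fraction `η` of itself (in particular it adds no new support). -/
theorem abs_tent_le_mul {w : ℕ → ℝ} {β η : ℝ} (hw : ∀ n, 0 ≤ w n) (hη : 0 ≤ η)
    (hβa : |β| * Real.sqrt a ≤ η * w a) (hβb : |β| * Real.sqrt b ≤ η * w b)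
    (hβc : |β| * Real.sqrt c ≤ η * w c) (n : ℕ) :
    |tent a b c β n| ≤ η * w n := by
  obtain ⟨hα, hγ⟩ := abs_edge_coeff_le ha hab hbc β
  by_cases hna : n = a
  · subst hna
    rw [tent_apply_a hab hbc, abs_mul, abs_of_nonneg (Real.sqrt_nonneg _)]
    exact (mul_le_mul_of_nonneg_right hα (Real.sqrt_nonneg _)).trans hβa
  by_cases hnb : n = b
  · subst hnb
    rw [tent_apply_b hab hbc, abs_mul, abs_neg, abs_of_nonneg (Real.sqrt_nonneg _)]
    exact hβb
  by_cases hnc : n = c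
  · subst hnc
    rw [tent_apply_c hab hbc, abs_mul, abs_of_nonneg (Real.sqrt_nonneg _)]
    exact (mul_le_mul_of_nonneg_right hγ (Real.sqrt_nonneg _)).trans hβc
  · rw [tent_apply_of_ne β hna hnb hnc, abs_zero]
    exact mul_nonneg hη (hw n)

/-- **Non-negativity and support are preserved** (`η ≤ 1`): `0 ≤ w + tent ≤ 2w` pointwise; in
particular `w(n) = 0 ⟹ (w + tent)(n) = 0` — a tent on prime powers keeps the weights prime-power
supported. -/
theorem add_tent_nonneg {w : ℕ → ℝ} {β η : ℝ} (hw : ∀ n, 0 ≤ w n) (hη : 0 ≤ η) (hη1 : η ≤ 1)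
    (hβa : |β| * Real.sqrt a ≤ η * w a) (hβb : |β| * Real.sqrt b ≤ η * w b)
    (hβc : |β| * Real.sqrt c ≤ η * w c) (n : ℕ) :
    0 ≤ (w + tent a b c β) n ∧ (w + tent a b c β) n ≤ 2 * w n ∧
      (w n = 0 → (w + tent a b c β) n = 0) := by
  have h := abs_tent_le_mul ha hab hbc hw hη hβa hβb hβc n
  have hwn := hw n
  have h' : |tent a b c β n| ≤ w n := h.trans (by nlinarith)
  rw [abs_le] at h'
  refine ⟨by rw [Pi.add_apply]; linarith, by rw [Pi.add_apply]; linarith, fun h0 ↦ ?_⟩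
  rw [Pi.add_apply, h0, zero_add]
  have : |tent a b c β n| ≤ 0 := h.trans (by rw [h0, mul_zero])
  exact abs_nonpos_iff.1 this

end size

/-! ## 5. The screw reading: `Ψ_w` and the lattice ceiling -/

/-- `Ψ_w(t) = Ψ(t) + φ(t) - φ_w(t)`: Suzuki's `Ψ` with its von Mangoldt prime sum replaced by `φ_w`. -/
noncomputable def screwW (w : ℕ → ℝ) (t : ℝ) : ℝ := zetaScrew t + zetaScrewPrimeSum t - primeSumW w t

/-- `Ψ_Λ = Ψ`. -/
theorem screwW_vonMangoldt (t : ℝ) :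
    screwW (fun n ↦ ArithmeticFunction.vonMangoldt n) t = zetaScrew t := by
  rw [screwW, primeSumW_vonMangoldt, add_sub_cancel_right]

/-- `CEIL_w(h)`: the lattice ceiling of `Ψ_w` — `∀ ε > 0, ∃ K, ∀ k, |Ψ_w(k h)| ≤ K e^{ε k}`.  For `w = Λ`
(and for every lattice-blind perturbation of `Λ`, `latticeCeilingW_add_tent_iff`) it is the open
`CEIL(h)`; RH-implied there (`ScrewLatticeContinuation.latticeCeiling_of_rh`). -/
@[conjecture] def LatticeCeilingW (w : ℕ → ℝ) (h : ℝ) : Prop :=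
  ∀ ε : ℝ, 0 < ε → ∃ K : ℝ, ∀ k : ℕ, |screwW w (k * h)| ≤ K * Real.exp (ε * k)

/-- `CEIL_Λ(h)` is the tree's `CEIL(h)` (`ScrewLatticeContinuation.LatticeCeiling`, file `ScrewLatticeContinuationA`). -/
theorem latticeCeilingW_vonMangoldt_iff (h : ℝ) :
    LatticeCeilingW (fun n ↦ ArithmeticFunction.vonMangoldt n) h ↔ LatticeCeiling h := by
  simp only [LatticeCeilingW, LatticeCeiling, screwW_vonMangoldt]

section screw

variable {a b c : ℕ} (ha : 1 ≤ a) (hab : a < b) (hbc : b < c) (β : ℝ)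
include ha hab hbc

/-- **The lattice cannot see the tent**: with the window inside one cell, every lattice sample of
`Ψ_{Λ + tent}` IS the lattice sample of `Ψ`. -/
theorem screwW_add_tent_lattice {h : ℝ} (hh : 0 ≤ h) {k : ℕ} (hka : k * h ≤ Real.log a)
    (hkc : Real.log c ≤ (k + 1) * h) (j : ℕ) :
    screwW ((fun n ↦ ArithmeticFunction.vonMangoldt n) + tent a b c β) (j * h) = zetaScrew (j * h) := by
  rw [screwW, primeSumW_add_tent_lattice ha hab hbc _ β hh hka hkc j, primeSumW_vonMangoldt,
    add_sub_cancel_right]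

/-- **… hence `CEIL(h)` of `Ψ_{Λ + tent}` is literally `CEIL(h)`.** -/
theorem latticeCeilingW_add_tent_iff {h : ℝ} (hh : 0 ≤ h) {k : ℕ} (hka : k * h ≤ Real.log a)
    (hkc : Real.log c ≤ (k + 1) * h) :
    LatticeCeilingW ((fun n ↦ ArithmeticFunction.vonMangoldt n) + tent a b c β) h ↔ LatticeCeiling h := by
  simp only [LatticeCeilingW, LatticeCeiling, screwW_add_tent_lattice ha hab hbc β hh hka hkc]

/-- **… yet at the apex `Ψ_{Λ + tent}(log b) = Ψ(log b) - β·B(a,b,c)`.** -/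
theorem screwW_add_tent_apex :
    screwW ((fun n ↦ ArithmeticFunction.vonMangoldt n) + tent a b c β) (Real.log b) =
      zetaScrew (Real.log b) - β * bumpConst a b c := by
  rw [screwW, primeSumW_add_tent_apex ha hab hbc _ β, primeSumW_vonMangoldt]
  ring

/-- Off the lattice the deviation is at most `|β| B(a,b,c)` everywhere and exactly `∓β B(a,b,c)` at the apex. -/
theorem abs_screwW_add_tent_sub_le (t : ℝ) :
    |screwW ((fun n ↦ ArithmeticFunction.vonMangoldt n) + tent a b c β) t - zetaScrew t| ≤
      |β| * bumpConst a b c := by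
  rw [screwW, primeSumW_add, primeSumW_vonMangoldt,
    show zetaScrew t + zetaScrewPrimeSum t - (zetaScrewPrimeSum t + primeSumW (tent a b c β) t) -
      zetaScrew t = -primeSumW (tent a b c β) t by ring, abs_neg]
  exact abs_primeSumW_tent_le ha hab hbc β t

end screw

/-! ## 6. Superposition: a block of tents with common feet -/

/-- Tents with common feet `a`, `c` and apexes `b ∈ S`, apex weights `β b`. -/
noncomputable def tentBlock (a c : ℕ) (S : Finset ℕ) (β : ℕ → ℝ) : ℕ → ℝ :=
  fun n ↦ ∑ b ∈ S, tent a b c (β b) n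

/-- `φ` of a tent block is the sum of the `φ`'s of its tents. -/
theorem primeSumW_tentBlock (a c : ℕ) (S : Finset ℕ) (β : ℕ → ℝ) (t : ℝ) :
    primeSumW (tentBlock a c S β) t = ∑ b ∈ S, primeSumW (tent a b c (β b)) t :=
  primeSumW_finset_sum S (fun b ↦ tent a b c (β b)) t

section block

variable {a c : ℕ} {S : Finset ℕ} (ha : 1 ≤ a) (hS : ∀ b ∈ S, a < b ∧ b < c) (w : ℕ → ℝ)
  (β : ℕ → ℝ)
include ha hS

/-- A block of tents is window-blind … -/
theorem primeSumW_add_tentBlock_eq_of_window {t : ℝ} (ht : |t| ≤ Real.log a ∨ Real.log c ≤ |t|) :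
    primeSumW (w + tentBlock a c S β) t = primeSumW w t := by
  rw [primeSumW_add, primeSumW_tentBlock, Finset.sum_eq_zero, add_zero]
  intro b hb
  obtain ⟨hab, hbc⟩ := hS b hb
  rcases ht with ht | ht
  · exact primeSumW_tent_of_le_log ha hab hbc _ ht
  · exact primeSumW_tent_of_log_le ha hab hbc _ ht

/-- … in particular lattice-blind when `e^{kh} ≤ a < c ≤ e^{(k+1)h}` … -/
theorem primeSumW_add_tentBlock_lattice {h : ℝ} (hh : 0 ≤ h) {k : ℕ} (hka : k * h ≤ Real.log a)
    (hkc : Real.log c ≤ (k + 1) * h) (j : ℕ) :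
    primeSumW (w + tentBlock a c S β) (j * h) = primeSumW w (j * h) := by
  refine primeSumW_add_tentBlock_eq_of_window ha hS w β ?_
  rw [abs_of_nonneg (by positivity)]
  rcases Nat.lt_or_ge j (k + 1) with hj | hj
  · left
    have hj' : (j : ℝ) ≤ k := by exact_mod_cast Nat.lt_succ_iff.1 hj
    exact (mul_le_mul_of_nonneg_right hj' hh).trans hka
  · right
    have hj' : ((k : ℝ) + 1) ≤ j := by exact_mod_cast hj
    exact hkc.trans (mul_le_mul_of_nonneg_right hj' hh)

/-- **(K4) … and LEFT OF THE BLOCK the deviation is exact**: for `log a ≤ |t| ≤ log b` (all `b ∈ S`),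
`φ_{w + block}(t) - φ_w(t) = (|t| - log a)/(log c - log a) · ∑_{b ∈ S} β_b (log c - log b)`. -/
theorem primeSumW_add_tentBlock_left {t : ℝ} (hta : Real.log a ≤ |t|) (htS : ∀ b ∈ S, |t| ≤ Real.log b) :
    primeSumW (w + tentBlock a c S β) t - primeSumW w t =
      (|t| - Real.log a) / (Real.log c - Real.log a) * ∑ b ∈ S, β b * (Real.log c - Real.log b) := by
  rw [primeSumW_add, add_sub_cancel_left, primeSumW_tentBlock, Finset.mul_sum]
  refine Finset.sum_congr rfl fun b hb ↦ ?_
  obtain ⟨hab, hbc⟩ := hS b hb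
  rw [primeSumW_tent_of_mem_left ha hab hbc _ hta (htS b hb)]
  ring

/-- Lower bound form: if `β ≥ 0` on `S` and every apex satisfies `log b ≤ M`, then left of the block
the deviation is at least `(|t| - log a)(log c - M)/(log c - log a) · ∑_{b ∈ S} β_b`. -/
theorem primeSumW_add_tentBlock_left_ge {t M : ℝ} (hta : Real.log a ≤ |t|)
    (htS : ∀ b ∈ S, |t| ≤ Real.log b) (hM : ∀ b ∈ S, Real.log b ≤ M) (hβ : ∀ b ∈ S, 0 ≤ β b)
    (hac : a < c) :
    (|t| - Real.log a) * (Real.log c - M) / (Real.log c - Real.log a) * ∑ b ∈ S, β b ≤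
      primeSumW (w + tentBlock a c S β) t - primeSumW w t := by
  have hL : 0 < Real.log c - Real.log a :=
    sub_pos.2 (Real.log_lt_log (by exact_mod_cast ha) (by exact_mod_cast hac))
  rw [primeSumW_add_tentBlock_left ha hS w β hta htS]
  have hrew : (|t| - Real.log a) * (Real.log c - M) / (Real.log c - Real.log a) * ∑ b ∈ S, β b =
      (|t| - Real.log a) / (Real.log c - Real.log a) * ∑ b ∈ S, β b * (Real.log c - M) := by
    rw [← Finset.sum_mul]
    ring
  rw [hrew]
  refine mul_le_mul_of_nonneg_left (Finset.sum_le_sum fun b hb ↦ ?_) (div_nonneg (by linarith) hL.le)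
  exact mul_le_mul_of_nonneg_left (by linarith [hM b hb]) (hβ b hb)

end block

end Summit.RiemannHypothesis.RiemannHypothesis.Theorems.Splittings.ScrewPrimeCellBlindness
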